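import Literature.Claims.NS.Tarver2016
import Literature.Analysis.FluidPDE.RadialCalculus
import Literature.Analysis.FluidPDE.SpaceTimeCalculus
import HarnessLib

/-!
# Tarver (2016), C80 — model file 1/3: the Gaussian spherical wave (explicit solution of `∂ₜ²W = ΔW`)

Companion to `Literature.Claims.NS.Tarver2016` (row C80 of cell `ns-claims`); consumed by
`…Theorems.SoloRefuteTarver2016ClaySwirl` (the vector wave and the datum) and
`…Theorems.SoloRefuteTarver2016Clay` (the kill `not_WaveGivesNS`). Kit by ns-claims-typist-1 g3.

Contents (all folklore calculus, nothing specific to the author):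
* two entire functions of one real variable, `E₀(σ) = Σ σⁿ/(2n)! = cosh √σ` and
  `E₁(σ) = Σ σⁿ/(2n+1)! = sinh √σ / √σ` (`entire k`, Mathlib `FormalMultilinearSeries.ofScalars`,
  infinite radius by comparison with `Σ σⁿ/n!`; values from `Real.hasSum_cosh/sinh`);
* the scalar Gaussian spherical wave `W(t, x) = e^{−|x|²−t²} (E₀(4t²|x|²) − 2t² E₁(4t²|x|²))` (`Wsc`):
  smooth on `ℝ × ℝ³` by construction, even in `t`, and `|x| W(t,x) = F(|x|−t) + F(|x|+t)` with
  `F(s) = s e^{−s²}/2` (`norm_mul_Wsc`: d'Alembert's formula for `rW`);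
* the spherical-wave identity `Δ (H(|·|)/|·|)(x) = H″(|x|)/|x|` off the origin
  (`laplacian_sphericalWave`, in the variable `σ = r²` through the tree's `laplacian_comp_norm_sq`;
  Evans, *PDE*, §2.4.1 (d)), whence `∂ₜ²W = ΔW` off the origin and, by continuity and density, on all of
  `ℝ × ℝ³` (`wave_Wsc`);
* the exchange `∂ₜ∇ₓ = ∇ₓ∂ₜ` for jointly smooth scalar fields (`hasDerivAt_gradient_slice`, from the
  tree's `IsSmoothSpaceTimeOn.hasDerivAt_fderiv_slice_clm`).

WHAT THIS IS NOT: not a statement about the Navier–Stokes problem itself; not about any author beyond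
the typed locator.
-/

noncomputable section

open Set Filter Topology InnerProductSpace Function
open Literature.Analysis.FluidPDE Literature.Analysis.FunctionSpaces Literature.Claims.NS.Tarver2016
open scoped RealInnerProductSpace Laplacian ContDiff SchwartzMap

-- The summit's canonical theorem namespace repeats the summit name (single-conjunct summit).
set_option linter.dupNamespace false

namespace Summit.NavierStokesRegularity.NavierStokesRegularity.Theorems.Tarver2016

/-- Local notation for physical space. -/
local notation "ℝ³" => EuclideanSpace ℝ (Fin 3)

/-! ## Two entire functions of `σ`: `E₀(σ) = Σ σⁿ/(2n)! = cosh √σ` and `E₁(σ) = Σ σⁿ/(2n+1)! = sinh √σ/√σ` -/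

/-- Coefficients `1/(2n+k)!`. [folklore] -/
def coef (k n : ℕ) : ℝ := 1 / ((2 * n + k).factorial : ℝ)

/-- `0 ≤ 1/(2n+k)!`. [folklore] -/
theorem coef_nonneg (k n : ℕ) : 0 ≤ coef k n := by unfold coef; positivity

/-- `1/(2n+k)! ≤ 1/n!` (since `n ≤ 2n+k`). [folklore] -/
theorem coef_le (k n : ℕ) : coef k n ≤ 1 / (n.factorial : ℝ) := by
  unfold coef
  have h : (n.factorial : ℝ) ≤ ((2 * n + k).factorial : ℝ) := by
    exact_mod_cast Nat.factorial_le (by omega)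
  exact one_div_le_one_div_of_le (by positivity) h

/-- The power series `Σ σⁿ/(2n+k)!` (one variable). [folklore] -/
def cser (k : ℕ) : FormalMultilinearSeries ℝ ℝ ℝ := FormalMultilinearSeries.ofScalars ℝ (coef k)

/-- The series `Σ σⁿ/(2n+k)!` has infinite radius of convergence (comparison with `Σ σⁿ/n!`). [folklore] -/
theorem cser_radius (k : ℕ) : (cser k).radius = ⊤ := by
  refine FormalMultilinearSeries.radius_eq_top_of_summable_norm _ fun r => ?_
  have hb : ∀ n, ‖cser k n‖ * (r : ℝ) ^ n ≤ (r : ℝ) ^ n / n.factorial := fun n => by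
    rw [cser, FormalMultilinearSeries.ofScalars_norm, Real.norm_of_nonneg (coef_nonneg k n),
      div_eq_mul_one_div, mul_comm]
    exact mul_le_mul_of_nonneg_left (coef_le k n) (by positivity)
  exact Summable.of_nonneg_of_le (fun n => by positivity) hb (Real.summable_pow_div_factorial r)

/-- The entire function `E_k(σ) = Σ σⁿ/(2n+k)!`. [folklore] -/
def entire (k : ℕ) (σ : ℝ) : ℝ := (cser k).sum σ

/-- `E_k` is the sum of its power series on the whole line (radius `⊤`). [folklore] -/
theorem hasFPowerSeriesOnBall_entire (k : ℕ) : HasFPowerSeriesOnBall (entire k) (cser k) 0 ⊤ := by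
  have h := (cser k).hasFPowerSeriesOnBall (by rw [cser_radius]; exact WithTop.top_pos)
  rw [cser_radius] at h
  exact h

/-- `E_k` is smooth (it is analytic on `ℝ`). [folklore] -/
theorem contDiff_entire (k : ℕ) {n : WithTop ℕ∞} : ContDiff ℝ n (entire k) := by
  have h := hasFPowerSeriesOnBall_entire k
  refine AnalyticOnNhd.contDiff (fun σ _ => h.analyticAt_of_mem ?_)
  simp

/-- `E_k(σ) = Σ' σⁿ/(2n+k)!`. [folklore] -/
theorem entire_eq_tsum (k : ℕ) (σ : ℝ) : entire k σ = ∑' n, coef k n * σ ^ n := by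
  have e : (cser k).sum = FormalMultilinearSeries.ofScalarsSum (E := ℝ) (coef k) := rfl
  rw [entire, e, FormalMultilinearSeries.ofScalars_sum_eq]
  simp [smul_eq_mul]

/-- `E_k(0) = 1/k!`. [folklore] -/
theorem entire_apply_zero (k : ℕ) : entire k 0 = coef k 0 := by
  have e : (cser k).sum = FormalMultilinearSeries.ofScalarsSum (E := ℝ) (coef k) := rfl
  rw [entire, e, FormalMultilinearSeries.ofScalarsSum_zero]
  simp

/-- `E₀(y²) = cosh y`. [folklore] -/
theorem entire_zero_sq (y : ℝ) : entire 0 (y ^ 2) = Real.cosh y := by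
  rw [entire_eq_tsum, Real.cosh_eq_tsum]
  refine tsum_congr fun n => ?_
  rw [coef, add_zero, ← pow_mul]
  ring

/-- `y E₁(y²) = sinh y`. [folklore] -/
theorem mul_entire_one_sq (y : ℝ) : y * entire 1 (y ^ 2) = Real.sinh y := by
  rw [entire_eq_tsum, ← (Real.hasSum_sinh y).tsum_eq, ← tsum_mul_left]
  refine tsum_congr fun n => ?_
  rw [coef, ← pow_mul, pow_succ]
  ring

/-! ### The scalar Gaussian spherical wave -/

/-- **The scalar wave** `W(t, x) = e^{−|x|²−t²} (E₀(4t²|x|²) − 2t² E₁(4t²|x|²))`, i.e.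
`e^{−r²−t²}(cosh 2tr − t sinh(2tr)/r) = (F(r−t)+F(r+t))/r`, `F(s) = s e^{−s²}/2`: the solution of
`∂ₜ²W = ΔW` on `ℝ × ℝ³` with data `(e^{−|x|²}, 0)` (d'Alembert for `rW`). [folklore] -/
def Wsc (t : ℝ) (x : ℝ³) : ℝ :=
  Real.exp (-‖x‖ ^ 2 - t ^ 2) *
    (entire 0 (4 * t ^ 2 * ‖x‖ ^ 2) - 2 * t ^ 2 * entire 1 (4 * t ^ 2 * ‖x‖ ^ 2))

/-- `W` is jointly smooth on `ℝ × ℝ³`. [folklore] -/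
theorem contDiff_Wsc : ContDiff ℝ ∞ (uncurry Wsc) := by
  have h1 : ContDiff ℝ ∞ fun q : ℝ × ℝ³ => ‖q.2‖ ^ 2 := (contDiff_norm_sq ℝ).comp contDiff_snd
  have h2 : ContDiff ℝ ∞ fun q : ℝ × ℝ³ => q.1 ^ 2 := contDiff_fst.pow 2
  have h3 : ContDiff ℝ ∞ fun q : ℝ × ℝ³ => 4 * q.1 ^ 2 * ‖q.2‖ ^ 2 := (contDiff_const.mul h2).mul h1
  have h : ContDiff ℝ ∞ fun q : ℝ × ℝ³ => Real.exp (-‖q.2‖ ^ 2 - q.1 ^ 2) *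
      (entire 0 (4 * q.1 ^ 2 * ‖q.2‖ ^ 2) - 2 * q.1 ^ 2 * entire 1 (4 * q.1 ^ 2 * ‖q.2‖ ^ 2)) :=
    (Real.contDiff_exp.comp (h1.neg.sub h2)).mul
      (((contDiff_entire 0).comp h3).sub ((contDiff_const.mul h2).mul ((contDiff_entire 1).comp h3)))
  exact h

/-- `W` is smooth as a space–time field on every time set. [folklore] -/
theorem isSmoothSpaceTimeOn_Wsc : IsSmoothSpaceTimeOn univ Wsc :=
  contDiff_Wsc.contDiffOn

/-- `W` is even in time. [folklore] -/
theorem Wsc_neg (t : ℝ) (x : ℝ³) : Wsc (-t) x = Wsc t x := by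
  simp [Wsc]

/-- The 1-D profile `F(s) = s e^{−s²}/2`. [folklore] -/
def Fp (s : ℝ) : ℝ := s * Real.exp (-s ^ 2) / 2

/-- `F'`. [folklore] -/
def Fp1 (s : ℝ) : ℝ := (1 - 2 * s ^ 2) * Real.exp (-s ^ 2) / 2

/-- `F''`. [folklore] -/
def Fp2 (s : ℝ) : ℝ := (2 * s ^ 3 - 3 * s) * Real.exp (-s ^ 2)

/-- `(e^{−s²})' = −2s e^{−s²}`. [folklore] -/
theorem hasDerivAt_expNegSq (s : ℝ) :
    HasDerivAt (fun s : ℝ => Real.exp (-s ^ 2)) (Real.exp (-s ^ 2) * (-(2 * s))) s := by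
  have h' : HasDerivAt (fun x : ℝ => -(x ^ 2)) (-(((2 : ℕ) : ℝ) * s ^ (2 - 1))) s :=
    (hasDerivAt_pow 2 s).neg
  have h : HasDerivAt (fun s : ℝ => -s ^ 2) (-(2 * s)) s := by
    simpa using h'
  exact h.exp

/-- `F' = F₁` (`Fp1`). [folklore] -/
theorem hasDerivAt_Fp (s : ℝ) : HasDerivAt Fp (Fp1 s) s := by
  have h : HasDerivAt (fun r : ℝ => r * Real.exp (-r ^ 2) / 2)
      ((1 * Real.exp (-s ^ 2) + s * (Real.exp (-s ^ 2) * (-(2 * s)))) / 2) s :=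
    ((hasDerivAt_id' s).mul (hasDerivAt_expNegSq s)).div_const 2
  have e : (1 * Real.exp (-s ^ 2) + s * (Real.exp (-s ^ 2) * (-(2 * s)))) / 2 = Fp1 s := by
    simp only [Fp1]; ring
  rw [← e]
  exact h

/-- `F₁' = F₂` (`Fp2`). [folklore] -/
theorem hasDerivAt_Fp1 (s : ℝ) : HasDerivAt Fp1 (Fp2 s) s := by
  have h1 : HasDerivAt (fun s : ℝ => 1 - 2 * s ^ 2) (-(2 * (2 * s))) s := by
    simpa using (((hasDerivAt_pow 2 s).const_mul 2).const_sub 1)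
  have h : HasDerivAt (fun r : ℝ => (1 - 2 * r ^ 2) * Real.exp (-r ^ 2) / 2)
      ((-(2 * (2 * s)) * Real.exp (-s ^ 2) + (1 - 2 * s ^ 2) * (Real.exp (-s ^ 2) * (-(2 * s)))) / 2)
      s :=
    (h1.mul (hasDerivAt_expNegSq s)).div_const 2
  have e : (-(2 * (2 * s)) * Real.exp (-s ^ 2) + (1 - 2 * s ^ 2) * (Real.exp (-s ^ 2) * (-(2 * s)))) / 2
      = Fp2 s := by
    simp only [Fp2]; ring
  rw [← e]
  exact h

/-- **Closed form**: `|x| · W(t, x) = F(|x| − t) + F(|x| + t)`. [folklore] -/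
theorem norm_mul_Wsc (t : ℝ) (x : ℝ³) : ‖x‖ * Wsc t x = Fp (‖x‖ - t) + Fp (‖x‖ + t) := by
  have hC : entire 0 (4 * t ^ 2 * ‖x‖ ^ 2) = Real.cosh (2 * t * ‖x‖) := by
    rw [show 4 * t ^ 2 * ‖x‖ ^ 2 = (2 * t * ‖x‖) ^ 2 by ring, entire_zero_sq]
  have hS : 2 * t ^ 2 * entire 1 (4 * t ^ 2 * ‖x‖ ^ 2) * ‖x‖ = t * Real.sinh (2 * t * ‖x‖) := by
    rw [show 4 * t ^ 2 * ‖x‖ ^ 2 = (2 * t * ‖x‖) ^ 2 by ring, ← mul_entire_one_sq]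
    ring
  have e1 : Real.exp (-(‖x‖ - t) ^ 2) = Real.exp (-‖x‖ ^ 2 - t ^ 2) * Real.exp (2 * t * ‖x‖) := by
    rw [← Real.exp_add]; congr 1; ring
  have e2 : Real.exp (-(‖x‖ + t) ^ 2) = Real.exp (-‖x‖ ^ 2 - t ^ 2) * Real.exp (-(2 * t * ‖x‖)) := by
    rw [← Real.exp_add]; congr 1; ring
  calc ‖x‖ * Wsc t x
      = Real.exp (-‖x‖ ^ 2 - t ^ 2) * (‖x‖ * entire 0 (4 * t ^ 2 * ‖x‖ ^ 2) -
          2 * t ^ 2 * entire 1 (4 * t ^ 2 * ‖x‖ ^ 2) * ‖x‖) := by rw [Wsc]; ring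
    _ = Real.exp (-‖x‖ ^ 2 - t ^ 2) * (‖x‖ * Real.cosh (2 * t * ‖x‖) - t * Real.sinh (2 * t * ‖x‖)) := by
          rw [hC, hS]
    _ = Fp (‖x‖ - t) + Fp (‖x‖ + t) := by
          rw [Real.cosh_eq, Real.sinh_eq, Fp, Fp, e1, e2]
          ring

/-- Off the origin: `W(t, x) = (F(|x| − t) + F(|x| + t)) / |x|`. [folklore] -/
theorem Wsc_eq_div {x : ℝ³} (hx : x ≠ 0) (t : ℝ) :
    Wsc t x = (Fp (‖x‖ - t) + Fp (‖x‖ + t)) / ‖x‖ := by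
  rw [← norm_mul_Wsc, mul_div_cancel_left₀ _ (norm_ne_zero_iff.mpr hx)]

/-! ### The scalar wave equation for `W` -/

/-- **Laplacian of a spherical wave** in `ℝ³`: if `H' = H₁` and `H₁' = H₂` on `(0, ∞)` then, off the
origin, `Δ (H(|·|)/|·|)(x) = H₂(|x|)/|x|` (i.e. `Δ(φ) = (rφ)''/r` for radial `φ`; Evans, *PDE*, §2.4.1
(d), in the variable `σ = r²` through the tree's `laplacian_comp_norm_sq`). [folklore] -/
theorem laplacian_sphericalWave {H H₁ H₂ : ℝ → ℝ} (hH : ∀ ρ : ℝ, 0 < ρ → HasDerivAt H (H₁ ρ) ρ)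
    (hH₁ : ∀ ρ : ℝ, 0 < ρ → HasDerivAt H₁ (H₂ ρ) ρ) {x : ℝ³} (hx : x ≠ 0) :
    (Δ (fun w : ℝ³ => H ‖w‖ / ‖w‖)) x = H₂ ‖x‖ / ‖x‖ := by
  have hfun : (fun w : ℝ³ => H ‖w‖ / ‖w‖) =
      fun w => (fun σ : ℝ => H (Real.sqrt σ) / Real.sqrt σ) (‖w‖ ^ 2) := by
    funext w
    simp only [Real.sqrt_sq (norm_nonneg w)]
  -- first derivative of the profile on `(0, ∞)`
  have hgd : ∀ σ ∈ Ioi (0 : ℝ), HasDerivAt (fun σ : ℝ => H (Real.sqrt σ) / Real.sqrt σ)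
      ((fun σ => (Real.sqrt σ * H₁ (Real.sqrt σ) - H (Real.sqrt σ)) / (2 * Real.sqrt σ ^ 3)) σ) σ := by
    intro σ hσ
    have hr : 0 < Real.sqrt σ := Real.sqrt_pos.mpr hσ
    have hsq : HasDerivAt Real.sqrt (1 / (2 * Real.sqrt σ)) σ := Real.hasDerivAt_sqrt (ne_of_gt hσ)
    have hcH : HasDerivAt (fun σ : ℝ => H (Real.sqrt σ)) (H₁ (Real.sqrt σ) * (1 / (2 * Real.sqrt σ))) σ :=
      (hH _ hr).comp σ hsq
    have h := hcH.div hsq hr.ne'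
    refine h.congr_deriv ?_
    field_simp
  -- second derivative of the profile at `σ₀ = |x|²`
  have hx2 : (0 : ℝ) < ‖x‖ ^ 2 := by positivity
  have hr : 0 < Real.sqrt (‖x‖ ^ 2) := Real.sqrt_pos.mpr hx2
  have hsq : HasDerivAt Real.sqrt (1 / (2 * Real.sqrt (‖x‖ ^ 2))) (‖x‖ ^ 2) :=
    Real.hasDerivAt_sqrt (ne_of_gt hx2)
  have hcH : HasDerivAt (fun σ : ℝ => H (Real.sqrt σ))
      (H₁ (Real.sqrt (‖x‖ ^ 2)) * (1 / (2 * Real.sqrt (‖x‖ ^ 2)))) (‖x‖ ^ 2) := (hH _ hr).comp _ hsq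
  have hcH₁ : HasDerivAt (fun σ : ℝ => H₁ (Real.sqrt σ))
      (H₂ (Real.sqrt (‖x‖ ^ 2)) * (1 / (2 * Real.sqrt (‖x‖ ^ 2)))) (‖x‖ ^ 2) := (hH₁ _ hr).comp _ hsq
  have hN : HasDerivAt (fun σ : ℝ => Real.sqrt σ * H₁ (Real.sqrt σ) - H (Real.sqrt σ))
      (1 / (2 * Real.sqrt (‖x‖ ^ 2)) * H₁ (Real.sqrt (‖x‖ ^ 2)) +
          Real.sqrt (‖x‖ ^ 2) * (H₂ (Real.sqrt (‖x‖ ^ 2)) * (1 / (2 * Real.sqrt (‖x‖ ^ 2)))) -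
        H₁ (Real.sqrt (‖x‖ ^ 2)) * (1 / (2 * Real.sqrt (‖x‖ ^ 2)))) (‖x‖ ^ 2) :=
    (hsq.mul hcH₁).sub hcH
  have hD : HasDerivAt (fun σ : ℝ => 2 * Real.sqrt σ ^ 3)
      (2 * (((3 : ℕ) : ℝ) * Real.sqrt (‖x‖ ^ 2) ^ (3 - 1) * (1 / (2 * Real.sqrt (‖x‖ ^ 2))))) (‖x‖ ^ 2) :=
    (hsq.pow 3).const_mul 2
  have hD0 : (2 * Real.sqrt (‖x‖ ^ 2) ^ 3) ≠ 0 := by positivity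
  have hg1d := hN.div hD hD0
  have key := laplacian_comp_norm_sq (E := ℝ³) isOpen_Ioi hgd (mem_Ioi.mpr hx2) hg1d
  rw [hfun, key, finrank_euclideanSpace_fin]
  have hs : Real.sqrt (‖x‖ ^ 2) = ‖x‖ := Real.sqrt_sq (norm_nonneg _)
  simp only [hs]
  have hx' : ‖x‖ ≠ 0 := norm_ne_zero_iff.mpr hx
  push_cast
  field_simp
  ring

/-- Second time derivative of `W` off the origin: `∂ₜ²W = (F''(r−t) + F''(r+t))/r`. [folklore] -/
theorem iteratedDeriv_two_Wsc {x : ℝ³} (hx : x ≠ 0) (t : ℝ) :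
    iteratedDeriv 2 (fun s => Wsc s x) t = (Fp2 (‖x‖ - t) + Fp2 (‖x‖ + t)) / ‖x‖ := by
  have hW : (fun s => Wsc s x) = fun s => (Fp (‖x‖ - s) + Fp (‖x‖ + s)) / ‖x‖ :=
    funext fun s => Wsc_eq_div hx s
  have ha : ∀ s : ℝ, HasDerivAt (fun s : ℝ => ‖x‖ - s) (-1) s := fun s => by
    simpa using (hasDerivAt_id s).const_sub ‖x‖
  have hb : ∀ s : ℝ, HasDerivAt (fun s : ℝ => ‖x‖ + s) 1 s := fun s => by
    simpa using (hasDerivAt_id s).const_add ‖x‖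
  have h1 : ∀ s, HasDerivAt (fun s => (Fp (‖x‖ - s) + Fp (‖x‖ + s)) / ‖x‖)
      ((Fp1 (‖x‖ - s) * (-1) + Fp1 (‖x‖ + s) * 1) / ‖x‖) s := fun s => by
    have hca : HasDerivAt (fun s => Fp (‖x‖ - s)) (Fp1 (‖x‖ - s) * (-1)) s :=
      (hasDerivAt_Fp _).comp s (ha s)
    have hcb : HasDerivAt (fun s => Fp (‖x‖ + s)) (Fp1 (‖x‖ + s) * 1) s :=
      (hasDerivAt_Fp _).comp s (hb s)
    exact (hca.add hcb).div_const ‖x‖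
  have hd1 : deriv (fun s => (Fp (‖x‖ - s) + Fp (‖x‖ + s)) / ‖x‖) =
      fun s => (Fp1 (‖x‖ - s) * (-1) + Fp1 (‖x‖ + s) * 1) / ‖x‖ := funext fun s => (h1 s).deriv
  have h2 : HasDerivAt (fun s => (Fp1 (‖x‖ - s) * (-1) + Fp1 (‖x‖ + s) * 1) / ‖x‖)
      ((Fp2 (‖x‖ - t) * (-1) * (-1) + Fp2 (‖x‖ + t) * 1 * 1) / ‖x‖) t := by
    have hca : HasDerivAt (fun s => Fp1 (‖x‖ - s)) (Fp2 (‖x‖ - t) * (-1)) t :=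
      (hasDerivAt_Fp1 _).comp t (ha t)
    have hcb : HasDerivAt (fun s => Fp1 (‖x‖ + s)) (Fp2 (‖x‖ + t) * 1) t :=
      (hasDerivAt_Fp1 _).comp t (hb t)
    exact ((hca.mul_const (-1)).add (hcb.mul_const 1)).div_const ‖x‖
  rw [hW, iteratedDeriv_succ, iteratedDeriv_one, hd1, h2.deriv]
  ring

/-- **The scalar wave equation off the origin**: `∂ₜ²W(t, x) = ΔW(t, ·)(x)` for `x ≠ 0`. [folklore] -/
theorem wave_Wsc_of_ne {x : ℝ³} (hx : x ≠ 0) (t : ℝ) :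
    iteratedDeriv 2 (fun s => Wsc s x) t = (Δ (Wsc t)) x := by
  rw [iteratedDeriv_two_Wsc hx]
  have hloc : (Wsc t) =ᶠ[𝓝 x] fun w => (fun ρ => Fp (ρ - t) + Fp (ρ + t)) ‖w‖ / ‖w‖ := by
    have ho : IsOpen ({0}ᶜ : Set ℝ³) := isOpen_compl_singleton
    filter_upwards [ho.mem_nhds (mem_compl_singleton_iff.mpr hx)] with w hw
    exact Wsc_eq_div (mem_compl_singleton_iff.mp hw) t
  rw [(laplacian_congr_nhds hloc).eq_of_nhds]
  have ha : ∀ ρ : ℝ, HasDerivAt (fun ρ : ℝ => ρ - t) 1 ρ := fun ρ => by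
    simpa using (hasDerivAt_id ρ).sub_const t
  have hb : ∀ ρ : ℝ, HasDerivAt (fun ρ : ℝ => ρ + t) 1 ρ := fun ρ => by
    simpa using (hasDerivAt_id ρ).add_const t
  have hH : ∀ ρ : ℝ, 0 < ρ → HasDerivAt (fun ρ => Fp (ρ - t) + Fp (ρ + t))
      ((fun ρ => Fp1 (ρ - t) * 1 + Fp1 (ρ + t) * 1) ρ) ρ := fun ρ _ => by
    have hca : HasDerivAt (fun ρ => Fp (ρ - t)) (Fp1 (ρ - t) * 1) ρ := (hasDerivAt_Fp _).comp ρ (ha ρ)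
    have hcb : HasDerivAt (fun ρ => Fp (ρ + t)) (Fp1 (ρ + t) * 1) ρ := (hasDerivAt_Fp _).comp ρ (hb ρ)
    exact hca.add hcb
  have hH₁ : ∀ ρ : ℝ, 0 < ρ → HasDerivAt (fun ρ => Fp1 (ρ - t) * 1 + Fp1 (ρ + t) * 1)
      ((fun ρ => Fp2 (ρ - t) * 1 * 1 + Fp2 (ρ + t) * 1 * 1) ρ) ρ := fun ρ _ => by
    have hca : HasDerivAt (fun ρ => Fp1 (ρ - t)) (Fp2 (ρ - t) * 1) ρ := (hasDerivAt_Fp1 _).comp ρ (ha ρ)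
    have hcb : HasDerivAt (fun ρ => Fp1 (ρ + t)) (Fp2 (ρ + t) * 1) ρ := (hasDerivAt_Fp1 _).comp ρ (hb ρ)
    exact (hca.mul_const 1).add (hcb.mul_const 1)
  rw [laplacian_sphericalWave hH hH₁ hx]
  simp only [mul_one]

/-- **The scalar wave equation on all of `ℝ × ℝ³`** (both sides are continuous in `x` and agree off
the origin). [folklore] -/
theorem wave_Wsc (t : ℝ) (x : ℝ³) : iteratedDeriv 2 (fun s => Wsc s x) t = (Δ (Wsc t)) x := by
  have hW := isSmoothSpaceTimeOn_Wsc
  have hW1 : IsSmoothSpaceTimeOn univ (fun s y => deriv (fun r => Wsc r y) s) :=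
    hW.isSmoothSpaceTimeOn_deriv isOpen_univ
  have hW2 : IsSmoothSpaceTimeOn univ
      (fun s y => deriv (fun r => (fun s y => deriv (fun r => Wsc r y) s) r y) s) :=
    hW1.isSmoothSpaceTimeOn_deriv isOpen_univ
  have hL : ∀ y : ℝ³, iteratedDeriv 2 (fun s => Wsc s y) t =
      (fun s y => deriv (fun r => (fun s y => deriv (fun r => Wsc r y) s) r y) s) t y := fun y => by
    rw [iteratedDeriv_succ, iteratedDeriv_one]
  have hc1 : Continuous fun y : ℝ³ =>
      (fun s y => deriv (fun r => (fun s y => deriv (fun r => Wsc r y) s) r y) s) t y :=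
    (hW2.contDiff_slice (mem_univ t)).continuous
  have hc2 : Continuous fun y : ℝ³ => (Δ (Wsc t)) y :=
    ((hW.laplacian uniqueDiffOn_univ).contDiff_slice (mem_univ t)).continuous
  haveI : Nontrivial ℝ³ := ⟨⟨EuclideanSpace.single 0 1, 0, by
    intro h
    have := congrArg (fun v : ℝ³ => v 0) h
    simp at this⟩⟩
  have heq := Continuous.ext_on (dense_compl_singleton (0 : ℝ³)) hc1 hc2 fun y hy => by
    have hy' : y ≠ 0 := fun h => hy (mem_singleton_iff.mpr h)
    show _ = (Δ (Wsc t)) y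
    rw [← hL y]
    exact wave_Wsc_of_ne hy' t
  rw [hL x]
  exact congrFun heq x

/-! ### Exchange of `∂ₜ` and `∇ₓ` -/

/-- **Exchange of `∂ₜ` and `∇ₓ`** for a jointly smooth scalar field (the tree's
`IsSmoothSpaceTimeOn.hasDerivAt_fderiv_slice_clm`, composed with the Riesz isometry). [folklore] -/
theorem hasDerivAt_gradient_slice {w : ℝ → ℝ³ → ℝ} (h : IsSmoothSpaceTimeOn univ w) (t : ℝ) (x : ℝ³) :
    HasDerivAt (fun s => gradient (w s) x) (gradient (fun y => deriv (fun s => w s y) t) x) t := by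
  set Lₑ : (ℝ³ →L[ℝ] ℝ) ≃L[ℝ] ℝ³ := (InnerProductSpace.toDual ℝ ℝ³).symm.toContinuousLinearEquiv with hL
  have h1 := h.hasDerivAt_fderiv_slice_clm isOpen_univ (mem_univ t) x
  have h2 : HasDerivAt (fun s => Lₑ (fderiv ℝ (w s) x))
      (Lₑ (fderiv ℝ (fun y => deriv (fun s => w s y) t) x)) t :=
    ((Lₑ : (ℝ³ →L[ℝ] ℝ) →L[ℝ] ℝ³).hasFDerivAt).comp_hasDerivAt t h1
  exact h2

end Summit.NavierStokesRegularity.NavierStokesRegularity.Theorems.Tarver2016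

end

-- WHAT THIS IS NOT: not a statement about the Navier–Stokes problem itself; not about any author beyond
-- the typed locator.
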